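import Summits.ABC.ABC.Theses.RootDecompJ
import Literature.NumberTheory.DiophantineGeometry.AbcWave0SUnitProofs
import HarnessLib

/-!
# Route RootDecompJ — aside `CampanaSupportRung` (item stmt-ABC-29508) — KNOWN

`Summit.ABC.ABC.Theses.RootDecompJ.CampanaSupportRung`: for every finite `S ⊆ ℕ` the hyperbolic
(`1/p + 1/q + 1/r < 1`) abc triples supported on `S` are bounded.  This is a THEOREM NOW: abc triples
supported on a finite set are finitely many by Mahler 1933 (the `S`-unit equation over `ℚ`; tree
theorem `Literature.NumberTheory.DiophantineGeometry.finite_setOf_isABCTriple_primeFactors_subset_holds`,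
sorry-free), so `c` is bounded on them; the hyperbolicity hypothesis is DECORATIVE (unused) — the
critic's certificate `J_SupportRungKnown.lean` (decomp-abc critic g2, via Stewart–Yu 1991) and the
tribunal census-trib-abc-5 read the item R-KNOWN / provable-now for exactly this reason.  Cell
decomp-abc writer LANDING LIST, door J; bookkeeping: not a BC5 witness, proves neither `ABC` nor any
crux of J.  [cite: Mahler1933a] [cite: BombieriGubler2006, Thm. 5.2.1]
-/

set_option linter.dupNamespace false

namespace Summit.ABC.ABC.Theorems

open Literature.NumberTheory.DiophantineGeometry in
/-- Item stmt-ABC-29508, literally the route decl `RootDecompJ.CampanaSupportRung` (the powerfulness-profile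
hypothesis is not used: Mahler's finiteness bounds every `S`-supported abc triple). -/
theorem rootDecompJ_campanaSupportRung_proof : Summit.ABC.ABC.Theses.RootDecompJ.CampanaSupportRung := by
  unfold Summit.ABC.ABC.Theses.RootDecompJ.CampanaSupportRung
  intro S
  obtain ⟨B, hB⟩ :=
    ((finite_setOf_isABCTriple_primeFactors_subset_holds S).image (fun t : ℕ × ℕ × ℕ => t.2.2)).bddAbove
  exact ⟨B, fun a b c ht hS _ => hB ⟨(a, b, c), ⟨ht, hS⟩, rfl⟩⟩

end Summit.ABC.ABC.Theorems
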